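import Summits.BirchSwinnertonDyer.Rank1Residual.Additive.TypeGThreeTower
import Summits.BirchSwinnertonDyer.Rank1Residual.Additive.X4SharpUnitFreeResidueNoLemma20
import Summits.BirchSwinnertonDyer.Rank1Residual.GaloisImage.ExoticThreeAdicImage
import Literature.NumberTheory.EllipticCurves.Wuthrich2014.ThreeAdicImageSupersingularProofs
import HarnessLib

/-!
# Every Kodaira-`I₀*` row of X4 at `p = 3`: the `3`-adic tower from surj(3) with NO binder, and the
# EXOTIC residue of the X4 end-state confined to the `e ≠ 2` rows
# (cell `b2b-bsdres`, team n1011, seat p14 gen 2, OWNERS row T-b1 kernel piece 5 — sequel of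
# `Additive/TypeGThreeTower.lean` p250368 and `Additive/X4SharpUnitFreeResidueNoLemma20.lean` p250513)

HONEST FRAMING (cell `b2b-bsdres`, run/shared/lean/b2b/bsd-rank1-residual/, verbatim in every
file): the goal of the cell is to DELETE the COMBINATION-SHAPED residual classes of the
Birch–Swinnerton-Dyer formula for ALL analytic-rank `≤ 1` elliptic curves over `ℚ` — "full BSD
formula for every rank `≤ 1` curve in class `C`" assembled STRICTLY from published theorems — so
that the rank-`≤ 1` remainder becomes exactly the CONSTRUCTION-SHAPED classes, which are TYPED
(missing-input `Prop`s), NOT attempted. This is not "finishing BSD". Team n1011 (N10 / N11, the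
additive block X4 ∧ `p = 3`): research route on the CONSTRUCTION-SHAPED class X4; no claim beyond the
stated classes; the label X4 is UNCHANGED by this file; nothing is booked. Theorems only (no
definition, no named fact minted; every published input is an explicit named-fact hypothesis).

## What this file proves

`Additive/TypeGThreeTower.lean` (p250368) proved the `3`-adic tower `∀ n, ρ̄_{E,3ⁿ} onto` from the
census bit surj(3) on every Kodaira-`I₀*` row of X4 at `3` (Delbourgo type (G): the twist `E^{(−3)}`
is GOOD at `3`) modulo ONE named fact, Wuthrich 2014 Lemma 20
(`Wuthrich2014.lemma20_surjective_threeAdic_of_semistable`, registry A9), needed only on the rows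
whose good twist is SUPERSINGULAR. That fact is now a THEOREM of the tree:
`Wuthrich2014.lemma20_surjective_threeAdic_of_semistable_holds`
(`Literature/…/Wuthrich2014/ThreeAdicImageSupersingularProofs.lean`, lit-kato gen 8: inertia count on
the `9`-torsion of the height-`2` formal group + Serre's lifting lemma with the determinant; the
good-ordinary and multiplicative cases `…/ThreeAdicImageOrdinaryProofs.lean`, lit-kato gen 7; an
independent proof of the supersingular case is n1011-p02/p05's T-b2 chain). Feeding it in:

* §1 `TypeG.towerSurj_three_of_surj` — `TypeG W 3 → Addv W 3 → Surj W 3 → ∀ n, ρ̄_{E,3ⁿ}` onto, NO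
  binder: on EVERY `I₀*` row of X4@3 (ordinary or supersingular twist) the tower is the census bit
  surj(3); `ClassX4.towerSurj_three_of_surj_of_typeG_or_potMult` — the whole locus (M) ∪ (G) of X4 at
  `3` (every row admitting a semistable quadratic twist); `TypeG.imageContainsSL2_three_of_surj` —
  Kato's (12.5.2); `TypeG.bigIm_three_of_surj` — hypothesis (im) of the Kolyvagin-system routes.
* §2 `X4RankZero.missingUpperBoundAt_three_of_katoSharp_of_typeG`,
  `X4RankZero.bsdp_three_of_katoSharp_of_typeG_of_shaAn_unit` — p250368's sharp-Kato upper half /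
  `BSD(E,3)` on X4 ∧ (G) ∧ `r_an = 0` ∧ surj(3) (binders `hKatoS`, GZK, modularity, `ord₃ ∏ c_ℓ =
  ord₃ c₃`, a Manin datum) with the `hL20` binder DELETED.
* §3 the EXOTIC residue of the X4 end-state confined to `e ≠ 2`:
  `ClassX4.not_potMult_and_not_typeG_of_not_towerSurj_three` (an X4@3 pair with surj(3) whose tower
  fails is potentially good with `E^{(−3)}` STILL additive — Kodaira II, III, IV, IV*, III*, II*),
  `exotic_iff_exotic_of_not_typeG`, and
  **`x4SharpUnitFree_iff_lower_and_residues_sharp_exoticTypeG_noL20`**: the eight-fact end-state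
  `x4SharpUnitFree_iff_lower_and_residues_sharp_noL20` (p250513) with the EXOTIC piece restricted to
  `¬ TypeG W 3` — no `I₀*` row of X4 at `3` is exotic.

Census reading (T-b1 engine 1, `HOME/b2b-bsdres-n1011-p14/tb1/`, EVIDENCE): the 2 683 X4@3 r0
residue cells that are Kodaira `I₀*` with supersingular twist no longer need a tower certificate or a
named fact for the tower; the EXOTIC signature (Elkies' 9-deficient image) lives on `e ≠ 2` rows
(evidence `exotic/EXOTIC-SIGNATURE.md`: `v₃(N) = 5` on Elkies' family). X4 stays CONSTRUCTION-SHAPED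
(the LOWER half is the located gap); nothing booked; no label change.

References: Wuthrich 2014 [Wuthrich2014] Lemma 20 (p. 399), Cor. 19 (p. 398); Kato 2004
[Kato2004Asterisque] (12.5.2) (p. 222), Thm. 13.4 (3) (p. 226), Thm. 14.5 (3) (p. 236), Prop. 14.16
(2) (p. 244), Thm. 17.4 (3) (p. 273); Delbourgo 1998 [Delbourgo1998] §1.5 (G) (p. 130), Prop. 4
(p. 144); Serre 1968 [SerreAbelianLadic1968] IV-23 Lemma 3; Silverman *AEC* [SilvermanAEC2009] X.4.14,
X.5 Cor. 5.4; Kim 2026 [Kim2022StructureSelmer] Conj. 1.10; Miller 2011 [Miller2011LMS] Def. 1.1.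
-/

noncomputable section

open scoped Classical

open WeierstrassCurve Literature.NumberTheory.EllipticCurves
  Literature.NumberTheory.EllipticCurves.ModularForms
  Literature.NumberTheory.EllipticCurves.Rank1Residual
  Literature.NumberTheory.EllipticCurves.Rank1Residual.Typed

namespace Summit.BirchSwinnertonDyer.Rank1Residual.Additive

variable {W : WeierstrassCurve ℚ} [W.IsElliptic] [W.IsGloballyMinimal]

/-! ### §1 The tower on every `I₀*` row of X4 at `3`, no binder -/

/-- **(G) at `p = 3` (Kodaira `I₀*`, ordinary OR supersingular twist): the `3`-adic tower of `E` from
surj(3), NO binder.** For `E/ℚ` additive at `3` of Delbourgo type (G) with `ρ̄_{E,3}` onto, `ρ̄_{E,3ⁿ}`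
is onto for every `n` — `TypeG.towerSurj_three_of_surj_of_lemma20` (p250368: pass to the globally
minimal model of the GOOD twist `E^{(−3)}`, apply Lemma 20 there, transport back along the twist) fed
with the tree's PROOF of Wuthrich's Lemma 20, `Wuthrich2014.lemma20_surjective_threeAdic_of_semistable_holds`.
[cite: Wuthrich2014, Lemma 20 (p. 399)] [cite: SerreAbelianLadic1968, Ch. IV §3.4, Lemma 3 (IV-23)]
[cite: SilvermanAEC2009, X.5 Cor. 5.4 and VII.5 Prop. 5.1] -/
theorem TypeG.towerSurj_three_of_surj [Fact (Nat.Prime 3)] (hG : TypeG W 3) (hadd : Addv W 3)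
    (hsurj : Surj W 3) (n : ℕ) : W.HasSurjectiveModNGaloisRep (3 ^ n : ℕ) :=
  TypeG.towerSurj_three_of_surj_of_lemma20 Wuthrich2014.lemma20_surjective_threeAdic_of_semistable_holds
    hG hadd hsurj n

/-- **The semistable-twist locus (M) ∪ (G) of X4 at `3`: surj(3) ⟹ tower, NO binder** — on an X4
pair at `3` that is potentially multiplicative (`ord₃ j < 0`, `ClassX4M.towerSurj_of_surj`) OR of
type (G) (§1), `ρ̄_{E,3}` onto gives `ρ̄_{E,3ⁿ}` onto for all `n`. These are exactly the rows of X4@3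
admitting a semistable quadratic twist. [cite: Wuthrich2014, Lemma 20 (p. 399)]
[cite: Kato2004Asterisque, (12.5.2) in Thm. 12.5 (4) (p. 222)] -/
theorem ClassX4.towerSurj_three_of_surj_of_typeG_or_potMult [Fact (Nat.Prime 3)] (hX : ClassX4 W 3)
    (hGM : TypeG W 3 ∨ padicValRat 3 W.j < 0) (hsurj : Surj W 3) (n : ℕ) :
    W.HasSurjectiveModNGaloisRep (3 ^ n : ℕ) :=
  ClassX4.towerSurj_three_of_surj_of_typeG_or_potMult_of_lemma20
    Wuthrich2014.lemma20_surjective_threeAdic_of_semistable_holds hX hGM hsurj n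

/-- **(G) at `p = 3` ∧ surj(3) ⟹ Kato's (12.5.2) at `3`** (the image of `Gal(ℚ̄/ℚ(ζ_{3^∞}))` in
`GL(T₃E)` contains `SL₂(ℤ₃)`): the printed hypothesis of Kato's Thms 12.5 (4) / 13.4 (3) / 14.5 (3) /
17.4 (3) holds on every `I₀*` row of X4@3 with `ρ̄_{E,3}` onto.
[cite: Kato2004Asterisque, (12.5.2) in Thm. 12.5 (4) (p. 222)] [cite: Wuthrich2014, Cor. 19 and Lemma 20 (p. 399)] -/
theorem TypeG.imageContainsSL2_three_of_surj [Fact (Nat.Prime 3)] (hG : TypeG W 3) (hadd : Addv W 3)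
    (hsurj : Surj W 3) : Kato2004.ImageContainsSL2 W 3 :=
  Kato2004.imageContainsSL2_of_forall_hasSurjectiveModNGaloisRep W 3
    (TypeG.towerSurj_three_of_surj hG hadd hsurj)

/-- **(G) at `p = 3` ∧ surj(3) ⟹ hypothesis (im) at `3`** (`BigIm W 3`: some `σ` fixing `ℚ(ζ_{3^∞})`
with `T₃E/(σ − 1)T₃E` free of rank one — Kato Thm. 13.4 (3) = BCS (im) = Skinner 2016 §2.5 (b) =
Kim–Nakamura `Hyp(ℚ,T₃E)` (a)), via `GaloisImage.bigIm_iff_imageContainsSL2_of_surj` (n1011-p13,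
T-a5 (i)). So no `I₀*` row of X4@3 with surj(3) is in the EXOTIC corner where (im) fails.
[cite: Kato2004Asterisque, Thm. 13.4 (3) (p. 226)] [cite: BurungaleCastellaSkinner2025, hypothesis (im)] -/
theorem TypeG.bigIm_three_of_surj [Fact (Nat.Prime 3)] (hG : TypeG W 3) (hadd : Addv W 3)
    (hsurj : Surj W 3) : BigIm W 3 :=
  (GaloisImage.bigIm_iff_imageContainsSL2_of_surj W 3 (by norm_num) hsurj).mpr
    (TypeG.imageContainsSL2_three_of_surj hG hadd hsurj)

/-! ### §2 (G) ∧ `r_an = 0` ∧ surj(3): the sharp-Kato upper half with neither certificate nor `hL20` -/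

/-- **X4 ∧ (G) ∧ `p = 3` ∧ `r_an = 0` ∧ surj(3): the sharp Kato upper half with NO tower certificate
and NO Lemma-20 binder** — p250368's
`X4RankZero.missingUpperBoundAt_three_of_katoSharp_of_typeG_of_lemma20` (A161 `hKatoS`, GZK,
modularity; `ord₃ ∏ c_ℓ = ord₃ c₃`; a Manin datum `D` with `3 ∤ c_D`) with `hL20` discharged by
`…_holds`. Serves the (G)-SUPERSINGULAR `I₀*` rows (on (G-ord) the component route
`ClassX4Gord.missingUpperBoundAt_three_of_katoComponent_of_surj` needs no Tamagawa / Manin bit).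
[cite: Kato2004Asterisque, Thm. 14.5 (3) (p. 236), Prop. 14.16 (2) (p. 244)] [cite: Wuthrich2014, Lemma 20 (p. 399)]
[cite: Miller2011LMS, Def. 1.1] -/
theorem X4RankZero.missingUpperBoundAt_three_of_katoSharp_of_typeG [Fact (Nat.Prime 3)]
    (hKatoS : Kato2004.rankZero_padicValNat_sha_le_sub_localTamagawa_of_additive_potGood_of_imageContainsSL2)
    (hGZK : rank_eq_analyticRank_of_analyticRank_le_one) (hmod : hasEntireLFunction_rat)
    (hr : W.analyticRank = 0) (hX : ClassX4 W 3) (hG : TypeG W 3) (hsurj : Surj W 3)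
    (htam : padicValNat 3 W.tamagawaProduct =
      padicValNat 3 ((W.baseChange ℚ_[3]).localTamagawaNumber ℤ_[3]))
    {N : ℕ} [NeZero N] (D : ModularParametrizationData W N) (hc : ¬ (3 : ℤ) ∣ D.maninConstant) :
    MissingUpperBoundAt W 3 :=
  X4RankZero.missingUpperBoundAt_three_of_katoSharp_of_typeG_of_lemma20 hKatoS hGZK hmod
    Wuthrich2014.lemma20_surjective_threeAdic_of_semistable_holds hr hX hG hsurj htam D hc

/-- **`BSD(E,3)` on X4 ∧ (G) ∧ `r_an = 0` ∧ surj(3) ∧ `ord₃ ∏ c_ℓ = ord₃ c₃` ∧ Manin datum ∧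
`3 ∤ #Ш_an`, with NO tower certificate and NO Lemma-20 binder** (p250368's
`…_of_lemma20_of_shaAn_unit` with `hL20` discharged). [cite: Kato2004Asterisque, Thm. 14.5 (3) (p. 236)]
[cite: Wuthrich2014, Lemma 20 (p. 399)] [cite: Miller2011LMS, §1 and Def. 1.1] -/
theorem X4RankZero.bsdp_three_of_katoSharp_of_typeG_of_shaAn_unit [Fact (Nat.Prime 3)]
    (hKatoS : Kato2004.rankZero_padicValNat_sha_le_sub_localTamagawa_of_additive_potGood_of_imageContainsSL2)
    (hGZK : rank_eq_analyticRank_of_analyticRank_le_one) (hmod : hasEntireLFunction_rat)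
    (hr : W.analyticRank = 0) (hX : ClassX4 W 3) (hG : TypeG W 3) (hsurj : Surj W 3)
    (htam : padicValNat 3 W.tamagawaProduct =
      padicValNat 3 ((W.baseChange ℚ_[3]).localTamagawaNumber ℤ_[3]))
    {N : ℕ} [NeZero N] (D : ModularParametrizationData W N) (hc : ¬ (3 : ℤ) ∣ D.maninConstant)
    {q : ℚ} (hq : shaAn W = (q : ℂ)) (hv : padicValRat 3 q = 0) : BSDp W 3 :=
  X4RankZero.bsdp_three_of_katoSharp_of_typeG_of_lemma20_of_shaAn_unit hKatoS hGZK hmod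
    Wuthrich2014.lemma20_surjective_threeAdic_of_semistable_holds hr hX hG hsurj htam D hc hq hv

/-! ### §3 The EXOTIC residue of the X4 end-state lives on the `e ≠ 2` rows -/

/-- **An X4 pair at `3` with `ρ̄_{E,3}` onto whose tower FAILS is neither potentially multiplicative
nor of type (G)**: it is potentially good with `E^{(−3)}` still additive at `3` (Kodaira II, III, IV,
IV*, III*, II* — semistability defect `e ∈ {3, 4, 6, 12}`), i.e. it admits no semistable quadratic
twist. [cite: Wuthrich2014, Lemma 20 (p. 399)] [cite: Kato2004Asterisque, (12.5.2) in Thm. 12.5 (4) (p. 222)] -/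
theorem ClassX4.not_potMult_and_not_typeG_of_not_towerSurj_three [Fact (Nat.Prime 3)]
    (hX : ClassX4 W 3) (hsurj : Surj W 3) (hnot : ¬ ∀ n : ℕ, W.HasSurjectiveModNGaloisRep (3 ^ n : ℕ)) :
    ¬ padicValRat 3 W.j < 0 ∧ ¬ TypeG W 3 :=
  ⟨fun hneg ↦ hnot (ClassX4.towerSurj_three_of_surj_of_typeG_or_potMult hX (Or.inr hneg) hsurj),
    fun hG ↦ hnot (ClassX4.towerSurj_three_of_surj_of_typeG_or_potMult hX (Or.inl hG) hsurj)⟩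

/-- **The EXOTIC hypothesis of the end-state, RESTRICTED to `¬ TypeG W 3`**: the EXOTIC piece
(`p = 3`, potentially good, surj(3), NOT (G-ord, `e = 2`), tower fails ⟹ upper half) of
`x4SharpUnitFree_iff_lower_and_residues_sharp_exoticFlat_noL20` (p250513) is EQUIVALENT to the same
statement on the rows that are not of type (G) at all — on every (G) row (ordinary or supersingular
twist) the premise "tower fails" contradicts §1; and `TypeGOrd W 3 → TypeG W 3`.
[cite: Wuthrich2014, Lemma 20 (p. 399)] [cite: Miller2011LMS, Def. 1.1] -/
theorem exotic_iff_exotic_of_not_typeG :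
    (∀ (W : WeierstrassCurve ℚ) [W.IsElliptic] [W.IsGloballyMinimal],
        W.analyticRank = 0 → ClassX4 W 3 → Surj W 3 → 0 ≤ padicValRat 3 W.j →
        ¬ (TypeGOrd W 3 ∧ semistabilityIndex W 3 = 2) →
        ¬ (∀ n : ℕ, W.HasSurjectiveModNGaloisRep (3 ^ n : ℕ)) → MissingUpperBoundAt W 3) ↔
    (∀ (W : WeierstrassCurve ℚ) [W.IsElliptic] [W.IsGloballyMinimal],
        W.analyticRank = 0 → ClassX4 W 3 → Surj W 3 → 0 ≤ padicValRat 3 W.j → ¬ TypeG W 3 →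
        ¬ (∀ n : ℕ, W.HasSurjectiveModNGaloisRep (3 ^ n : ℕ)) → MissingUpperBoundAt W 3) := by
  haveI : Fact (Nat.Prime 3) := ⟨Nat.prime_three⟩
  constructor
  · intro h V _ _ hr hX hs hj hnG hnot
    exact h V hr hX hs hj (fun hGe ↦ hnG hGe.1.typeG) hnot
  · intro h V _ _ hr hX hs hj _ hnot
    exact h V hr hX hs hj (ClassX4.not_potMult_and_not_typeG_of_not_towerSurj_three hX hs hnot).2 hnot

/-- **THE END-STATE OF CLASS X4 ON EIGHT NAMED FACTS with the EXOTIC piece on the `e ≠ 2` rows only: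
X4♯(unit-free) ⟺ LOWER ∧ EXOTIC(¬(G)) ∧ TAM-DEFECT₂♭ ∧ ODD-SHA♭ ∧ MANIN♭** —
`x4SharpUnitFree_iff_lower_and_residues_sharp_noL20` (p250513; binders `hCT`, `hKatoS`, `hDel`,
`hGZK`, `hmod`, `hmodD`, `hKatoχ`, `hK`) rewritten along `exotic_iff_exotic_of_not_typeG`: the EXOTIC
residue (surj(3), `ord₃ j ≥ 0`, tower fails) is now quantified over the rows with `¬ TypeG W 3` only
— potentially good with NO semistable quadratic twist (Kodaira II/III/IV/IV*/III*/II* at `3`). No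
named fact beyond the eight; X4 stays CONSTRUCTION-SHAPED; nothing booked.
[cite: Kato2004Asterisque, Thm. 14.5 (3) (p. 236), Thm. 17.4 (3) (p. 273)] [cite: Delbourgo1998, Prop. 4 (p. 144)]
[cite: Wuthrich2014, Lemma 20 (p. 399)] [cite: SilvermanAEC2009, Thm. X.4.14]
[cite: Kim2022StructureSelmer, Conj. 1.10 (PDF p. 8)] [cite: Miller2011LMS, Def. 1.1] -/
theorem x4SharpUnitFree_iff_lower_and_residues_sharp_exoticTypeG_noL20
    (hCT : exists_casselsTate_pairing (K := ℚ))
    (hKatoS : Kato2004.rankZero_padicValNat_sha_le_sub_localTamagawa_of_additive_potGood_of_imageContainsSL2)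
    (hDel : Delbourgo1998.prop4_rankZero_pow_dvd_constantCoeff)
    (hGZK : rank_eq_analyticRank_of_analyticRank_le_one) (hmod : hasEntireLFunction_rat)
    (hmodD : nonempty_modularParametrizationData)
    (hKatoχ : Wuthrich2014.kato_halfEigenCharIdeal_dvd_cyclotomicPrime_of_surjective)
    (hK : Kato2004.charIdeal_dvd_padicLFunctionBranch_component_of_surjective) :
    X4SharpUnitFree ↔
      (∀ (W : WeierstrassCurve ℚ) [W.IsElliptic] [W.IsGloballyMinimal] (p : ℕ) [Fact p.Prime],
          W.analyticRank = 0 → ClassX4 W p → Surj W p → MissingLowerBoundAt W p) ∧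
      (∀ (W : WeierstrassCurve ℚ) [W.IsElliptic] [W.IsGloballyMinimal],
          W.analyticRank = 0 → ClassX4 W 3 → Surj W 3 → 0 ≤ padicValRat 3 W.j → ¬ TypeG W 3 →
          ¬ (∀ n : ℕ, W.HasSurjectiveModNGaloisRep (3 ^ n : ℕ)) → MissingUpperBoundAt W 3) ∧
      (∀ (W : WeierstrassCurve ℚ) [W.IsElliptic] [W.IsGloballyMinimal] (p : ℕ) [Fact p.Prime],
          W.analyticRank = 0 → ClassX4 W p → Surj W p → 0 ≤ padicValRat p W.j →
          ¬ (TypeGOrd W p ∧ semistabilityIndex W p = 2) →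
          padicValNat p ((W.baseChange ℚ_[p]).localTamagawaNumber ℤ_[p]) + 2 ≤
            padicValNat p W.tamagawaProduct →
          MissingUpperBoundAt W p) ∧
      (∀ (W : WeierstrassCurve ℚ) [W.IsElliptic] [W.IsGloballyMinimal] (p : ℕ) [Fact p.Prime],
          W.analyticRank = 0 → ClassX4 W p → Surj W p → 0 ≤ padicValRat p W.j →
          ¬ (TypeGOrd W p ∧ semistabilityIndex W p = 2) →
          (∃ q : ℚ, shaAn W = (q : ℂ) ∧ Odd (padicValRat p q)) → MissingUpperBoundAt W p) ∧
      (∀ (W : WeierstrassCurve ℚ) [W.IsElliptic] [W.IsGloballyMinimal] (p : ℕ) [Fact p.Prime],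
          W.analyticRank = 0 → ClassX4 W p → Surj W p → 0 ≤ padicValRat p W.j →
          ¬ (TypeGOrd W p ∧ semistabilityIndex W p = 2) →
          (∀ (N : ℕ) [NeZero N] (D : ModularParametrizationData W N), (p : ℤ) ∣ D.maninConstant) →
          MissingUpperBoundAt W p) := by
  rw [x4SharpUnitFree_iff_lower_and_residues_sharp_exoticFlat_noL20 hCT hKatoS hDel hGZK hmod hmodD
    hKatoχ hK, exotic_iff_exotic_of_not_typeG]

end Summit.BirchSwinnertonDyer.Rank1Residual.Additive

end
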